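import Mathlib
import HarnessLib
import Summits.ValiantsHypothesis.ValiantsHypothesis.Theorems.LacunarySymmetroidMatrixDescartesProductPlusOneSixthOrderCloudCell
import Summits.ValiantsHypothesis.ValiantsHypothesis.Theorems.LacunarySymmetroidMatrixDescartesProductPlusOneSixthOrderLetterRows

/-!
# LINE (A) `product_plus_one` (crux `MatrixDescartes`, stmt-ValiantsHypothesis-18050, V1) — W-CB §30.1 (i) + §30.5 C5, THE FULL ORDER-6 WINDOW CELL (K = 3):
# ★★ E3b's localisation cell WITH CLOUDS — binomial rows off their rings AND trinomial clouds on their isolated-sign sides ⇒ at most SIX roots of `W(∏_j f_j)`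

`K = 3`, `d 0 < d 1 < d 2`, `3(d1−d0) ≤ d2−d0` (= E3b's `2(e₁+1) ≤ e₂+1`, `p = d1−d0`, `s = d2−d1`); window `(u,v)`, `0 < u`.  MENU (each row `a j` one of):
 (K01) `a j 2 = 0 ∧ 0 < a j 0·a j 1` slow knee — free;  (P01) `a j 2 = 0 ∧ a j 0·a j 1 < 0 ∧ 0 ≤ f_j(u)f_j(v)` slow pole;
 (K12) `a j 0 = 0 ∧ 0 < a j 1·a j 2 ∧` ring missed (`0 < 6(s−p)(2s−p)(2s+p)(3s+p) + 240(3s+p)(2s−p)ψ₁ + 5040ψ₁²` on the window);  (P12) middle pole, root outside;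
 (K02) `a j 1 = 0 ∧ 0 < a j 0·a j 2 ∧` ring missed (fast coefficients);  (P02) fast pole, root outside;
 (C↓) cloud with isolated BOTTOM sign on the side `a j 0·f_j > 0`;  (C↑) cloud with isolated TOP sign on the side `a j 0·f_j < 0`;
 (IMG) any row with non-vanishing stripped form and positive order-8 image on the window
(ψ₁ and the image in the every-K tower ✓ `…RowTowerKDefs`/`…Defs8` at `n = 1`).  THEN `#{t ∈ (u,v) : W(∏_j f_j)(t) = 0} ≤ 6`.
= ✓⧗ `sixthOrderCloudCell_wronskian_roots_le_six` (val-lit-p5 g17) with the letter rows routed through ✓⧗ `sixthOrder_letterRow_image_pos` (E1's pure-real sign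
theorems of val-lit-p7 g18 + the every-K letter images).  E3b ✓ `sixthOrder_ringfree_wronskian_roots_le_six` is the sub-menu (K01)…(P02) in the binomial
currency; the new rows are the clouds (C5): in a one-change company of the floor, EVERY row now has a free side.  The other cloud sides (switched T5 /
flat T4) and rings meeting the window remain the charged cases (memo §30.2 / §34) and are NOT covered.

HONEST FRAMING: ONE W-cell (helper); nothing about `WronskianBudgetK3` / `OneChangeFloorK3` / the stubs / 18050 / `MatrixDescartes`; `VP ≠ VNP` is NOT proved.
No definitions, no named facts, no sorry.
-/

set_option linter.dupNamespace false

namespace Summit.ValiantsHypothesis.ValiantsHypothesis.Theorems.LacunarySymmetroidMatrixDescartes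

namespace ProductPlusOne

open Finset Set Polynomial
open scoped BigOperators Topology Polynomial

/-- ★★ **THE FULL ORDER-6 WINDOW CELL** (K = 3, LINE shape; menu (K01)…(P02), (C↓), (C↑), (IMG) of the module docstring): at most SIX roots of
`W(∏_j f_j)` in the window. [this file's theorem] -/
theorem sixthOrderFullCell_wronskian_roots_le_six {m : ℕ} (d : Fin 3 → ℕ) (hd : StrictMono d) (h3 : 3 * (d 1 - d 0) ≤ d 2 - d 0)
    (a : Fin m → Fin 3 → ℝ) {u v : ℝ} (hu : 0 < u)
    (hrow : ∀ j,
      (a j 2 = 0 ∧ 0 < a j 0 * a j 1) ∨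
      (a j 2 = 0 ∧ a j 0 * a j 1 < 0 ∧
          0 ≤ (∑ l, C (a j l) * X ^ (d l) : ℝ[X]).eval u * (∑ l, C (a j l) * X ^ (d l) : ℝ[X]).eval v) ∨
      (a j 0 = 0 ∧ 0 < a j 1 * a j 2 ∧ ∀ x ∈ Ioo u v,
          0 < 6 * (((((d 2 - d 0 : ℕ) : ℝ) - ((d 1 - d 0 : ℕ) : ℝ)) - ((d 1 - d 0 : ℕ) : ℝ))
                * (2 * (((d 2 - d 0 : ℕ) : ℝ) - ((d 1 - d 0 : ℕ) : ℝ)) - ((d 1 - d 0 : ℕ) : ℝ))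
                * (2 * (((d 2 - d 0 : ℕ) : ℝ) - ((d 1 - d 0 : ℕ) : ℝ)) + ((d 1 - d 0 : ℕ) : ℝ))
                * (3 * (((d 2 - d 0 : ℕ) : ℝ) - ((d 1 - d 0 : ℕ) : ℝ)) + ((d 1 - d 0 : ℕ) : ℝ)))
            + 240 * ((3 * (((d 2 - d 0 : ℕ) : ℝ) - ((d 1 - d 0 : ℕ) : ℝ)) + ((d 1 - d 0 : ℕ) : ℝ))
                * (2 * (((d 2 - d 0 : ℕ) : ℝ) - ((d 1 - d 0 : ℕ) : ℝ)) - ((d 1 - d 0 : ℕ) : ℝ)))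
                * rowPsiK1 (fun l : Fin 2 => d l.succ - d 0) (a j 0) (fun l : Fin 2 => -(a j l.succ)) x
            + 5040 * rowPsiK1 (fun l : Fin 2 => d l.succ - d 0) (a j 0) (fun l : Fin 2 => -(a j l.succ)) x ^ 2) ∨
      (a j 0 = 0 ∧ a j 1 * a j 2 < 0 ∧
          0 ≤ (∑ l, C (a j l) * X ^ (d l) : ℝ[X]).eval u * (∑ l, C (a j l) * X ^ (d l) : ℝ[X]).eval v) ∨
      (a j 1 = 0 ∧ 0 < a j 0 * a j 2 ∧ ∀ x ∈ Ioo u v,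
          0 < 6 * (12 * ((d 1 - d 0 : ℕ) : ℝ) ^ 4 + 56 * ((d 1 - d 0 : ℕ) : ℝ) ^ 3 * (((d 2 - d 0 : ℕ) : ℝ) - ((d 1 - d 0 : ℕ) : ℝ))
                + 89 * ((d 1 - d 0 : ℕ) : ℝ) ^ 2 * (((d 2 - d 0 : ℕ) : ℝ) - ((d 1 - d 0 : ℕ) : ℝ)) ^ 2
                + 56 * ((d 1 - d 0 : ℕ) : ℝ) * (((d 2 - d 0 : ℕ) : ℝ) - ((d 1 - d 0 : ℕ) : ℝ)) ^ 3
                + 12 * (((d 2 - d 0 : ℕ) : ℝ) - ((d 1 - d 0 : ℕ) : ℝ)) ^ 4)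
            + 120 * (12 * ((d 1 - d 0 : ℕ) : ℝ) ^ 2 + 26 * ((d 1 - d 0 : ℕ) : ℝ) * (((d 2 - d 0 : ℕ) : ℝ) - ((d 1 - d 0 : ℕ) : ℝ))
                + 12 * (((d 2 - d 0 : ℕ) : ℝ) - ((d 1 - d 0 : ℕ) : ℝ)) ^ 2)
                * rowPsiK1 (fun l : Fin 2 => d l.succ - d 0) (a j 0) (fun l : Fin 2 => -(a j l.succ)) x
            + 5040 * rowPsiK1 (fun l : Fin 2 => d l.succ - d 0) (a j 0) (fun l : Fin 2 => -(a j l.succ)) x ^ 2) ∨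
      (a j 1 = 0 ∧ a j 0 * a j 2 < 0 ∧
          0 ≤ (∑ l, C (a j l) * X ^ (d l) : ℝ[X]).eval u * (∑ l, C (a j l) * X ^ (d l) : ℝ[X]).eval v) ∨
      (a j 0 * a j 1 < 0 ∧ a j 0 * a j 2 < 0 ∧
          ∀ x ∈ Ioo u v, 0 < a j 0 * (a j 0 + a j 1 * x ^ (d 1 - d 0) + a j 2 * x ^ (d 2 - d 0))) ∨
      (0 < a j 0 * a j 1 ∧ a j 0 * a j 2 < 0 ∧
          ∀ x ∈ Ioo u v, a j 0 * (a j 0 + a j 1 * x ^ (d 1 - d 0) + a j 2 * x ^ (d 2 - d 0)) < 0) ∨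
      (∀ x ∈ Ioo u v, a j 0 + a j 1 * x ^ (d 1 - d 0) + a j 2 * x ^ (d 2 - d 0) ≠ 0 ∧
          0 < rowPsiK7 (fun l : Fin 2 => d l.succ - d 0) (a j 0) (fun l : Fin 2 => -(a j l.succ)) x
            - (((d 1 - d 0 : ℕ) : ℝ) ^ 2 + (((d 2 - d 0 : ℕ) : ℝ) - ((d 1 - d 0 : ℕ) : ℝ)) ^ 2 + ((d 2 - d 0 : ℕ) : ℝ) ^ 2)
                * rowPsiK5 (fun l : Fin 2 => d l.succ - d 0) (a j 0) (fun l : Fin 2 => -(a j l.succ)) x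
            + (((d 1 - d 0 : ℕ) : ℝ) ^ 2 * (((d 2 - d 0 : ℕ) : ℝ) - ((d 1 - d 0 : ℕ) : ℝ)) ^ 2
                  + ((d 1 - d 0 : ℕ) : ℝ) ^ 2 * ((d 2 - d 0 : ℕ) : ℝ) ^ 2
                  + (((d 2 - d 0 : ℕ) : ℝ) - ((d 1 - d 0 : ℕ) : ℝ)) ^ 2 * ((d 2 - d 0 : ℕ) : ℝ) ^ 2)
                * rowPsiK3 (fun l : Fin 2 => d l.succ - d 0) (a j 0) (fun l : Fin 2 => -(a j l.succ)) x
            - (((d 1 - d 0 : ℕ) : ℝ) ^ 2 * (((d 2 - d 0 : ℕ) : ℝ) - ((d 1 - d 0 : ℕ) : ℝ)) ^ 2 * ((d 2 - d 0 : ℕ) : ℝ) ^ 2)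
                * rowPsiK1 (fun l : Fin 2 => d l.succ - d 0) (a j 0) (fun l : Fin 2 => -(a j l.succ)) x)) :
    (((∏ j, ∑ l, C (a j l) * X ^ (d l) : ℝ[X]) * (X * derivative (X * derivative (∏ j, ∑ l, C (a j l) * X ^ (d l) : ℝ[X])))
        - (X * derivative (∏ j, ∑ l, C (a j l) * X ^ (d l) : ℝ[X])) ^ 2).roots.toFinset.filter (fun t => u < t ∧ t < v)).card ≤ 6 := by
  refine sixthOrderCloudCell_wronskian_roots_le_six d hd h3 a hu fun j => ?_
  rcases hrow j with h | h | h | h | h | h | h | h | h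
  · exact Or.inr (Or.inr fun x hx => sixthOrder_letterRow_image_pos d hd h3 (a j) hu (Or.inl h) hx)
  · exact Or.inr (Or.inr fun x hx => sixthOrder_letterRow_image_pos d hd h3 (a j) hu (Or.inr (Or.inl h)) hx)
  · exact Or.inr (Or.inr fun x hx => sixthOrder_letterRow_image_pos d hd h3 (a j) hu (Or.inr (Or.inr (Or.inl h))) hx)
  · exact Or.inr (Or.inr fun x hx => sixthOrder_letterRow_image_pos d hd h3 (a j) hu (Or.inr (Or.inr (Or.inr (Or.inl h)))) hx)
  · exact Or.inr (Or.inr fun x hx => sixthOrder_letterRow_image_pos d hd h3 (a j) hu (Or.inr (Or.inr (Or.inr (Or.inr (Or.inl h))))) hx)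
  · exact Or.inr (Or.inr fun x hx => sixthOrder_letterRow_image_pos d hd h3 (a j) hu (Or.inr (Or.inr (Or.inr (Or.inr (Or.inr h))))) hx)
  · exact Or.inl h
  · exact Or.inr (Or.inl h)
  · exact Or.inr (Or.inr h)

end ProductPlusOne

end Summit.ValiantsHypothesis.ValiantsHypothesis.Theorems.LacunarySymmetroidMatrixDescartes
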